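import Mathlib
import Summits.Ventures.PercRepro2.Defs
import Summits.Ventures.PercRepro2.Graph
import Summits.Ventures.PercRepro2.OneColourSwitch

/-!
# `m9` for pendant `p, q` — the mirror of `OneColourSwitch.m9SignSum_nonpos_of_pendant` (blind cell
PercRepro2, p3 g15, 2026-08-27; `proofs/P3-CPNC.md` §8c)

The `m9` sign-form sum `Σ_{Sep} σ_pq σ_rs` of `OneColourSwitch` is symmetric in the two pairs
(`m9SignSum_comm`: `Sep` is symmetric and the two colour preferences commute), so the pendant class
theorem for `r, s` gives the one for `p, q` (`m9SignSum_nonpos_of_pendant'`).  Own work; std axioms.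
-/

namespace Summit.Ventures.PercRepro2

namespace OneColourSwitch

open Finset Classical

variable {V : Type*} {E : Type*}
variable (ends : E → Sym2 V)

/-! ## The mirror: `m9` for pendant `p, q` (the sign form is symmetric in the two pairs) -/

section Mirror

variable [Fintype E] [DecidableEq E]

omit [Fintype E] [DecidableEq E] in
/-- The two-colour separation is symmetric in the two pairs. -/
lemma sep2_comm {p q r s : V} {ω : Config E} :
    sep2 ends p q r s ω ↔ sep2 ends r s p q ω := by
  simp only [sep2, sepY]
  constructor
  · rintro ⟨⟨h1, h2, h3, h4⟩, ⟨h5, h6, h7, h8⟩⟩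
    exact ⟨⟨fun h => h1 (conn_symm h), fun h => h3 (conn_symm h), fun h => h2 (conn_symm h),
      fun h => h4 (conn_symm h)⟩, ⟨fun h => h5 (conn_symm h), fun h => h7 (conn_symm h),
      fun h => h6 (conn_symm h), fun h => h8 (conn_symm h)⟩⟩
  · rintro ⟨⟨h1, h2, h3, h4⟩, ⟨h5, h6, h7, h8⟩⟩
    exact ⟨⟨fun h => h1 (conn_symm h), fun h => h3 (conn_symm h), fun h => h2 (conn_symm h),
      fun h => h4 (conn_symm h)⟩, ⟨fun h => h5 (conn_symm h), fun h => h7 (conn_symm h),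
      fun h => h6 (conn_symm h), fun h => h8 (conn_symm h)⟩⟩

/-- The `m9` sign-form sum is symmetric in the two pairs. -/
theorem m9SignSum_comm (p q r s : V) : m9SignSum ends p q r s = m9SignSum ends r s p q := by
  unfold m9SignSum
  refine Finset.sum_congr rfl (fun ω _ => ?_)
  by_cases h : sep2 ends p q r s ω
  · rw [if_pos h, if_pos ((sep2_comm ends).1 h), mul_comm]
  · rw [if_neg h, if_neg (fun h' => h ((sep2_comm ends).2 h'))]

/-- **`m9` in sign form for pendant `p, q`** (the mirror of `m9SignSum_nonpos_of_pendant`). -/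
theorem m9SignSum_nonpos_of_pendant' {p q r s : V} {e₁ e₂ : E} (hp : Pendant ends p e₁)
    (hq : Pendant ends q e₂) (hrp : r ≠ p) (hrq : r ≠ q) (hsp : s ≠ p) (hsq : s ≠ q) (hpq : p ≠ q) :
    m9SignSum ends p q r s ≤ 0 := by
  rw [m9SignSum_comm]
  exact m9SignSum_nonpos_of_pendant hp hq hrp hrq hsp hsq hpq

end Mirror

end OneColourSwitch

end Summit.Ventures.PercRepro2
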